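import Mathlib
import Literature.NumberTheory.LFunctions.Zhang2022.Section16NsetRemovableR
import Literature.NumberTheory.LFunctions.Zhang2022.Section16BLocRatio
import Literature.NumberTheory.LFunctions.Zhang2022.AppendixALemma161Typed
import Literature.NumberTheory.Automorphic.AutomorphicLFunctionSplittingProofs
import Literature.Analysis.Complex.HolomorphicProducts
import HarnessLib

/-!
# Zhang (2022) §16 p. 93: the pointwise LOCAL MULTIPLICATIVE MAJORANT of `|ϖ₂ⱼ(n₁)|τ₃(n₁)` on
# `𝒩(𝔮)` (T3-s `varpi2_localMajorant`; closes `Typed.Section16B.Inline16_varpi2WeightSum`)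

Topic `Literature/NumberTheory/LFunctions/Zhang2022` (Landau–Siegel audit tree; verdict-neutral).
Y. Zhang, *Discrete mean estimates and the Landau–Siegel zero*, arXiv:2211.02515v1 (2022)
[Zhang2022LandauSiegel] — **an unrefereed manuscript under adjudication**; nothing here bears on its
Theorems 1–2. ZHANG-L discharge lane (WP16, seat zl-w16-p4; RULING W16-S5a T3-s).

`ϖ₂ⱼ(n) = 𝓜₂*(1−β_j)⁻¹ Σ_{n=dl} λ₂(d)d^{β_j}χ(l)𝓜₂(d,l;1−β_j)` (§16 p. 93, tex L4596;
`Typed.Section16B.varpi2`). For the weight sum of (16.15) one needs, at every `𝔮`-smooth `n₁`,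
`|ϖ₂ⱼ(n₁)|τ₃(n₁) ≤ K₀∏_{q^r∥n₁}a(q,r)` with `a(q,1) = 6 + O(1/q)` (the hypothesis of
`inline16_varpi2WeightSum_of_localMajorant`). Route (division-free, no multiplicativity of the inner
sum): (i) for `dl = n`, `𝓜₂(d,l;s) = E(n,s)·∏_{q∣n}F_q(d,l;s)` with `E(n,s) = ∏'_{q∤n}F_q(1,1;s)`,
`‖E‖ ≤ e^{450}` at `s = 1−β_j` (locality `calM2Factor_eq_one_one_of_coprime`, splitting
`Literature.NumberTheory.Automorphic.prod_mul_tprod_compl_of_multipliable`,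
`summable_norm_calM2Factor_one_one_sub_one`, `Literature.Analysis.Complex.norm_tprod_le_exp_tsum_const`);
(ii) per prime and for ALL `(d,l)`, from the closed form of the Euler factor
(`calM2Factor_eq_closedForm`, `basic_local_bounds`): `‖F_q(d,l;1−β_j)‖ ≤ 1 + 23/q` (`q ≥ 23`),
`≤ 132` (all `q`), `‖λ₂(q)‖ ≤ 1 + 3/q`, `≤ 3`; (iii) `|Σ_{dl=n}λ₂(d)d^βχ(l)∏F| ≤ τ₂(n)∏_{q∣n}θ_q`,
`θ_q = (1+66/q)(1+2882/q)`, so `τ₃|ϖ₂ⱼ| ≤ (e^{450}/c₀)∏_{q^r∥n}(r+1)²(r+2)θ_q/2`, and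
`(r+1)²(r+2) ≤ 54(3/2)^r`; `1/|𝓜₂*(1−β_j)| ≤ 1/c₀` by Lemma 16.1
(`inline16_calM2starLarge_of_lemma161`, `AppendixA.lemma161_holds`). Theorems only; no definitions.

## References

* Y. Zhang, arXiv:2211.02515v1 (2022), §16 pp. 91–94 (tex L4537–L4640), App. A p. 105.
  [cite: Zhang2022LandauSiegel, §16 (16.15) p.94]
-/

noncomputable section

open Complex Real Finset
open Literature.NumberTheory.LFunctions.Zhang2022
open Literature.NumberTheory.LFunctions.Zhang2022.Skeleton
open Literature.NumberTheory.LFunctions.Zhang2022.Typed.Section16A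
open Literature.NumberTheory.LFunctions.Zhang2022.AppendixA

namespace Literature.NumberTheory.LFunctions.Zhang2022.Typed.Section16B

/-! ## §1. Crude local bounds at every prime (`|v| ≤ 1`, `|w| ≤ 1`, `|x| ≤ 1/q`, `q ≥ 2`) -/

/-- `‖1 − z‖ ≥ 1 − ‖z‖`. [folklore] -/
private theorem one_sub_norm_le (z : ℂ) : 1 - ‖z‖ ≤ ‖1 - z‖ := by
  have := norm_sub_norm_le (1 : ℂ) z; rwa [norm_one] at this

/-- **Crude bounds for the building blocks of the closed form of `F_q(d,l;s)`**, valid at every prime: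
for `q ≥ 2`, `‖v‖ ≤ 1`, `‖w‖ ≤ 1`, `‖x‖ ≤ 1/q`:
`‖locPref v w x‖ ≤ 6`, `‖locLam v w q‖ ≤ 3`, `‖(1 − wv/q)⁻¹‖ ≤ 2`, `‖(w−1)x/(1−wx)‖ ≤ 2`,
`‖(vq/(q−1))·x(1−x)/(1−wx)‖ ≤ 3`. [cite: Zhang2022LandauSiegel, App. A p.105] -/
theorem crude_local_bounds {v w x : ℂ} {q : ℕ} (hq : 2 ≤ q) (hv : ‖v‖ ≤ 1) (hw : ‖w‖ ≤ 1)
    (hx : ‖x‖ ≤ (q : ℝ)⁻¹) :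
    ‖locPref v w x‖ ≤ 6 ∧ ‖locLam v w q‖ ≤ 3 ∧ ‖(1 - w * (v / q))⁻¹‖ ≤ 2 ∧
      ‖(w - 1) * x / (1 - w * x)‖ ≤ 2 ∧
      ‖v * q / ((q : ℂ) - 1) * (x * (1 - x) / (1 - w * x))‖ ≤ 3 := by
  have hq2 : (2 : ℝ) ≤ q := by exact_mod_cast hq
  have hq0 : (0 : ℝ) < q := by linarith
  set t : ℝ := (q : ℝ)⁻¹ with ht
  have ht0 : 0 < t := by positivity
  have ht2 : t ≤ 1 / 2 := by rw [ht, inv_eq_one_div]; exact div_le_div_of_nonneg_left (by norm_num) (by norm_num) hq2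
  -- sizes of the small quantities
  have hwx : ‖w * x‖ ≤ t := by
    rw [norm_mul]; calc ‖w‖ * ‖x‖ ≤ 1 * t := by gcongr
      _ = t := one_mul t
  have hvx : ‖v * x‖ ≤ t := by
    rw [norm_mul]; calc ‖v‖ * ‖x‖ ≤ 1 * t := by gcongr
      _ = t := one_mul t
  have hvq : ‖v / (q : ℂ)‖ ≤ t := by
    rw [norm_div, Complex.norm_natCast, ht, div_eq_mul_inv]
    calc ‖v‖ * (q : ℝ)⁻¹ ≤ 1 * (q : ℝ)⁻¹ := by gcongr
      _ = (q : ℝ)⁻¹ := one_mul _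
  have hwvq : ‖w * (v / (q : ℂ))‖ ≤ t := by
    rw [norm_mul]; calc ‖w‖ * ‖v / (q : ℂ)‖ ≤ 1 * t := by gcongr
      _ = t := one_mul t
  have hvwq : ‖v * w / (q : ℂ)‖ ≤ t := by
    rw [show v * w / (q : ℂ) = w * (v / q) by ring]; exact hwvq
  -- lower bounds `≥ 1/2` for the denominators
  have hden : ∀ {z : ℂ}, ‖z‖ ≤ t → 1 / 2 ≤ ‖1 - z‖ ∧ ‖(1 - z)⁻¹‖ ≤ 2 := by
    intro z hz
    have h1 : 1 / 2 ≤ ‖1 - z‖ := by linarith [one_sub_norm_le z]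
    refine ⟨h1, ?_⟩
    rw [norm_inv]
    calc ‖1 - z‖⁻¹ ≤ (1 / 2 : ℝ)⁻¹ := inv_anti₀ (by norm_num) h1
      _ = 2 := by norm_num
  have hup : ∀ {z : ℂ}, ‖z‖ ≤ t → ‖1 - z‖ ≤ 3 / 2 := by
    intro z hz
    calc ‖1 - z‖ ≤ ‖(1 : ℂ)‖ + ‖z‖ := norm_sub_le _ _
      _ ≤ 1 + 1 / 2 := by rw [norm_one]; linarith
      _ = 3 / 2 := by norm_num
  obtain ⟨h1x, h1x'⟩ := hden (le_of_eq_of_le rfl (hx.trans le_rfl))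
  obtain ⟨h1vx, -⟩ := hden hvx
  obtain ⟨h1wx, h1wx'⟩ := hden hwx
  obtain ⟨h1vq, h1vq'⟩ := hden hvq
  obtain ⟨-, h1wvq'⟩ := hden hwvq
  refine ⟨?_, ?_, h1wvq', ?_, ?_⟩
  · -- `locPref = (1 − wx)/((1−x)(1−vx))`
    unfold locPref
    rw [norm_div, norm_mul]
    have hlow : (1 / 4 : ℝ) ≤ ‖1 - x‖ * ‖1 - v * x‖ := by nlinarith
    calc ‖1 - w * x‖ / (‖1 - x‖ * ‖1 - v * x‖) ≤ (3 / 2) / (1 / 4) := by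
          exact div_le_div₀ (by norm_num) (hup hwx) (by norm_num) hlow
      _ = 6 := by norm_num
  · unfold locLam
    rw [norm_div]
    calc ‖1 - v * w / (q : ℂ)‖ / ‖1 - v / (q : ℂ)‖ ≤ (3 / 2) / (1 / 2) :=
          div_le_div₀ (by norm_num) (hup hvwq) (by norm_num) h1vq
      _ = 3 := by norm_num
  · rw [norm_div, norm_mul]
    have hw1 : ‖w - 1‖ ≤ 2 := by
      calc ‖w - 1‖ ≤ ‖w‖ + ‖(1 : ℂ)‖ := norm_sub_le _ _
        _ ≤ 1 + 1 := by rw [norm_one]; linarith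
        _ = 2 := by norm_num
    calc ‖w - 1‖ * ‖x‖ / ‖1 - w * x‖ ≤ 2 * (1 / 2) / (1 / 2) := by
          exact div_le_div₀ (by norm_num) (by nlinarith [norm_nonneg x, norm_nonneg (w - 1)])
            (by norm_num) h1wx
      _ = 2 := by norm_num
  · -- `‖vq/(q−1)‖ ≤ 2`, `‖x(1−x)/(1−wx)‖ ≤ t(3/2)/(1/2) ≤ 3/2`
    have hq1 : ‖(q : ℂ) - 1‖ = (q : ℝ) - 1 := by
      rw [show (q : ℂ) - 1 = (((q : ℝ) - 1 : ℝ) : ℂ) by push_cast; ring, Complex.norm_real,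
        Real.norm_eq_abs, abs_of_nonneg (by linarith)]
    have hA : ‖v * q / ((q : ℂ) - 1)‖ ≤ 2 := by
      rw [norm_div, norm_mul, Complex.norm_natCast, hq1, div_le_iff₀ (by linarith)]
      nlinarith
    have hB : ‖x * (1 - x) / (1 - w * x)‖ ≤ 3 / 2 := by
      rw [norm_div, norm_mul]
      calc ‖x‖ * ‖1 - x‖ / ‖1 - w * x‖ ≤ (1 / 2) * (3 / 2) / (1 / 2) := by
            refine div_le_div₀ (by norm_num) ?_ (by norm_num) h1wx
            exact mul_le_mul (hx.trans ht2) (hup (hx.trans le_rfl)) (norm_nonneg _) (by norm_num)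
        _ = 3 / 2 := by norm_num
    rw [norm_mul]
    calc ‖v * q / ((q : ℂ) - 1)‖ * ‖x * (1 - x) / (1 - w * x)‖ ≤ 2 * (3 / 2) :=
          mul_le_mul hA hB (norm_nonneg _) (by norm_num)
      _ = 3 := by norm_num

/-- **`‖F_q(d,l;1−β_j)‖ ≤ 132` at every prime `q`, for all `d, l`** (closed form
`calM2Factor_eq_closedForm` and `crude_local_bounds`: `6·(1 + 3·(2·2 + 3)) = 132`).
[cite: Zhang2022LandauSiegel, §16 p.91 (u021), App. A p.105] -/
theorem norm_calM2Factor_le_crude (c' : ℝ) {D : ℕ} (χ : DirichletCharacter ℂ D) {q : ℕ}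
    (hq : q.Prime) (d l j : ℕ) : ‖calM2Factor c' χ q d l (1 - betaJ c' D j)‖ ≤ 132 := by
  set s : ℂ := 1 - betaJ c' D j with hs
  have hs0 : 0 < s.re := by rw [hs, one_sub_betaJ_re]; norm_num
  set v : ℂ := χ (q : ZMod D) with hv
  set w : ℂ := (q : ℂ) ^ (-beta1 c' D) with hw
  set x : ℂ := (q : ℂ) ^ (-s) with hx
  have hvn : ‖v‖ ≤ 1 := DirichletCharacter.norm_le_one χ _
  have hwn : ‖w‖ ≤ 1 := le_of_eq (norm_cpow_neg_beta1 c' hq.pos).1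
  have hxn : ‖x‖ ≤ (q : ℝ)⁻¹ := le_of_eq (norm_cpow_neg_one_sub_betaJ c' hq.pos j)
  obtain ⟨hP, hL, hC, hA, hB⟩ := crude_local_bounds (v := v) (w := w) (x := x) hq.two_le hvn hwn hxn
  rw [calM2Factor_eq_closedForm c' χ hq d l hs0]
  have hΛ : ‖(if Nat.Coprime q d then locLam v w q else 1 : ℂ)‖ ≤ 3 := by
    split_ifs
    · exact hL
    · rw [norm_one]; norm_num
  have hCd : ‖(if Nat.Coprime q d then (1 - w * (v / q))⁻¹ else 1 : ℂ)‖ ≤ 2 := by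
    split_ifs
    · exact hC
    · rw [norm_one]; norm_num
  have hι : ‖(if Nat.Coprime q l then (1 : ℂ) else 0)‖ ≤ 1 := by
    split_ifs <;> simp
  -- the inner bracket
  have hinner : ‖(if Nat.Coprime q d then (1 - w * (v / q))⁻¹ else 1 : ℂ) * (w - 1) * x / (1 - w * x) -
      (if Nat.Coprime q l then (1 : ℂ) else 0) * (v * q / ((q : ℂ) - 1)) *
        (x * (1 - x) / (1 - w * x))‖ ≤ 2 * 2 + 1 * 3 := by
    refine (norm_sub_le _ _).trans (add_le_add ?_ ?_)
    · rw [show (if Nat.Coprime q d then (1 - w * (v / q))⁻¹ else 1 : ℂ) * (w - 1) * x / (1 - w * x) =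
          (if Nat.Coprime q d then (1 - w * (v / q))⁻¹ else 1 : ℂ) * ((w - 1) * x / (1 - w * x)) by ring,
        norm_mul]
      exact mul_le_mul hCd hA (norm_nonneg _) (by norm_num)
    · rw [norm_mul, norm_mul]
      calc ‖(if Nat.Coprime q l then (1 : ℂ) else 0)‖ * ‖v * q / ((q : ℂ) - 1)‖ *
            ‖x * (1 - x) / (1 - w * x)‖
          = ‖(if Nat.Coprime q l then (1 : ℂ) else 0)‖ *
              (‖v * q / ((q : ℂ) - 1)‖ * ‖x * (1 - x) / (1 - w * x)‖) := by ring
        _ ≤ 1 * 3 := by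
            refine mul_le_mul hι ?_ (by positivity) (by norm_num)
            rw [← norm_mul]; exact hB
  have hbr : ‖1 + (if Nat.Coprime q d then locLam v w q else 1 : ℂ) *
      ((if Nat.Coprime q d then (1 - w * (v / q))⁻¹ else 1 : ℂ) * (w - 1) * x / (1 - w * x) -
        (if Nat.Coprime q l then (1 : ℂ) else 0) * (v * q / ((q : ℂ) - 1)) *
          (x * (1 - x) / (1 - w * x)))‖ ≤ 22 := by
    refine (norm_add_le _ _).trans ?_
    rw [norm_one, norm_mul]
    have := mul_le_mul hΛ hinner (norm_nonneg _) (by norm_num)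
    linarith
  rw [norm_mul]
  calc ‖locPref v w x‖ * _ ≤ 6 * 22 := mul_le_mul hP hbr (norm_nonneg _) (by norm_num)
    _ = 132 := by norm_num

/-- **`‖λ₂(q)‖ ≤ 3` at every prime.** [cite: Zhang2022LandauSiegel, §16 p.90 (u014)] -/
theorem norm_lam2_prime_le_three (c' : ℝ) {D : ℕ} (χ : DirichletCharacter ℂ D) {q : ℕ}
    (hq : q.Prime) : ‖lam2 c' χ q 1‖ ≤ 3 := by
  rw [lam2_prime_one_eq_locLam c' χ hq]
  have hvn : ‖χ (q : ZMod D)‖ ≤ 1 := DirichletCharacter.norm_le_one χ _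
  have hwn : ‖(q : ℂ) ^ (-beta1 c' D)‖ ≤ 1 := le_of_eq (norm_cpow_neg_beta1 c' hq.pos).1
  have hxn : ‖(q : ℂ) ^ (-(1 - betaJ c' D 1))‖ ≤ (q : ℝ)⁻¹ :=
    le_of_eq (norm_cpow_neg_one_sub_betaJ c' hq.pos 1)
  exact (crude_local_bounds hq.two_le hvn hwn hxn).2.1

/-! ## §2. Sharp local bounds for `q ≥ 23` -/

/-- **`‖F_q(d,l;1−β_j)‖ ≤ 1 + 23/q` for every prime `q ≥ 23` and all `d, l`** (closed form and
`basic_local_bounds`: `‖locPref‖ ≤ 1 + 4/q`, bracket `≤ 1 + 16/q`).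
[cite: Zhang2022LandauSiegel, §16 p.93 (u034), App. A p.105] -/
theorem norm_calM2Factor_le_sharp (c' : ℝ) {D : ℕ} (χ : DirichletCharacter ℂ D) {q : ℕ}
    (hq : q.Prime) (h23 : 23 ≤ q) (d l j : ℕ) :
    ‖calM2Factor c' χ q d l (1 - betaJ c' D j)‖ ≤ 1 + 23 / (q : ℝ) := by
  set s : ℂ := 1 - betaJ c' D j with hs
  have hs0 : 0 < s.re := by rw [hs, one_sub_betaJ_re]; norm_num
  set v : ℂ := χ (q : ZMod D) with hv
  set w : ℂ := (q : ℂ) ^ (-beta1 c' D) with hw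
  set x : ℂ := (q : ℂ) ^ (-s) with hx
  have hq0 : (0 : ℝ) < q := by exact_mod_cast hq.pos
  have hq23 : (23 : ℝ) ≤ q := by exact_mod_cast h23
  have hvn : ‖v‖ ≤ 1 := DirichletCharacter.norm_le_one χ _
  have hwn : ‖w‖ ≤ 1 := le_of_eq (norm_cpow_neg_beta1 c' hq.pos).1
  have hxn : ‖x‖ ≤ (q : ℝ)⁻¹ := le_of_eq (norm_cpow_neg_one_sub_betaJ c' hq.pos j)
  obtain ⟨hA, hB, hC, hL, -⟩ := basic_local_bounds (v := v) (w := w) (x := x) h23 hvn hwn hxn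
  set t : ℝ := (q : ℝ)⁻¹ with ht
  have ht0 : 0 < t := by positivity
  have ht23 : t ≤ 1 / 23 := by
    rw [ht, inv_eq_one_div]; exact div_le_div_of_nonneg_left (by norm_num) (by norm_num) hq23
  have htq : t * q = 1 := by rw [ht]; field_simp
  -- `‖locPref‖ ≤ 1 + 4t`
  have hwx : ‖w * x‖ ≤ t := by
    rw [norm_mul]; calc ‖w‖ * ‖x‖ ≤ 1 * t := by gcongr
      _ = t := one_mul t
  have hvx : ‖v * x‖ ≤ t := by
    rw [norm_mul]; calc ‖v‖ * ‖x‖ ≤ 1 * t := by gcongr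
      _ = t := one_mul t
  have hlow1 : 1 - t ≤ ‖1 - x‖ := by linarith [one_sub_norm_le x]
  have hlow2 : 1 - t ≤ ‖1 - v * x‖ := by linarith [one_sub_norm_le (v * x)]
  have hup : ‖1 - w * x‖ ≤ 1 + t := by
    calc ‖1 - w * x‖ ≤ ‖(1 : ℂ)‖ + ‖w * x‖ := norm_sub_le _ _
      _ ≤ 1 + t := by rw [norm_one]; linarith
  have hP : ‖locPref v w x‖ ≤ 1 + 4 * t := by
    unfold locPref
    rw [norm_div, norm_mul]
    have h1t : 0 < 1 - t := by linarith
    have hlow : (1 - t) * (1 - t) ≤ ‖1 - x‖ * ‖1 - v * x‖ :=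
      mul_le_mul hlow1 hlow2 h1t.le (norm_nonneg _)
    calc ‖1 - w * x‖ / (‖1 - x‖ * ‖1 - v * x‖) ≤ (1 + t) / ((1 - t) * (1 - t)) :=
          div_le_div₀ (by linarith) hup (by positivity) hlow
      _ ≤ 1 + 4 * t := by
          rw [div_le_iff₀ (by positivity)]; nlinarith
  rw [calM2Factor_eq_closedForm c' χ hq d l hs0]
  have hΛ : ‖(if Nat.Coprime q d then locLam v w q else 1 : ℂ)‖ ≤ 2 := by
    split_ifs
    · exact hL
    · rw [norm_one]; norm_num
  have hCd : ‖(if Nat.Coprime q d then (1 - w * (v / q))⁻¹ else 1 : ℂ)‖ ≤ 2 := by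
    split_ifs
    · exact hC
    · rw [norm_one]; norm_num
  have hι : ‖(if Nat.Coprime q l then (1 : ℂ) else 0)‖ ≤ 1 := by
    split_ifs <;> simp
  have hinner : ‖(if Nat.Coprime q d then (1 - w * (v / q))⁻¹ else 1 : ℂ) * (w - 1) * x / (1 - w * x) -
      (if Nat.Coprime q l then (1 : ℂ) else 0) * (v * q / ((q : ℂ) - 1)) *
        (x * (1 - x) / (1 - w * x))‖ ≤ 2 * (3 / q) + 1 * (2 / q) := by
    refine (norm_sub_le _ _).trans (add_le_add ?_ ?_)
    · rw [show (if Nat.Coprime q d then (1 - w * (v / q))⁻¹ else 1 : ℂ) * (w - 1) * x / (1 - w * x) =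
          (if Nat.Coprime q d then (1 - w * (v / q))⁻¹ else 1 : ℂ) * ((w - 1) * x / (1 - w * x)) by ring,
        norm_mul]
      exact mul_le_mul hCd hA (norm_nonneg _) (by norm_num)
    · rw [norm_mul, norm_mul]
      calc ‖(if Nat.Coprime q l then (1 : ℂ) else 0)‖ * ‖v * q / ((q : ℂ) - 1)‖ *
            ‖x * (1 - x) / (1 - w * x)‖
          = ‖(if Nat.Coprime q l then (1 : ℂ) else 0)‖ *
              (‖v * q / ((q : ℂ) - 1)‖ * ‖x * (1 - x) / (1 - w * x)‖) := by ring
        _ ≤ 1 * (2 / q) := by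
            refine mul_le_mul hι ?_ (by positivity) (by norm_num)
            rw [← norm_mul]; exact hB
  have hbr : ‖1 + (if Nat.Coprime q d then locLam v w q else 1 : ℂ) *
      ((if Nat.Coprime q d then (1 - w * (v / q))⁻¹ else 1 : ℂ) * (w - 1) * x / (1 - w * x) -
        (if Nat.Coprime q l then (1 : ℂ) else 0) * (v * q / ((q : ℂ) - 1)) *
          (x * (1 - x) / (1 - w * x)))‖ ≤ 1 + 16 * t := by
    refine (norm_add_le _ _).trans ?_
    rw [norm_one, norm_mul]
    have := mul_le_mul hΛ hinner (norm_nonneg _) (by norm_num)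
    have e : (2 : ℝ) * (2 * (3 / q) + 1 * (2 / q)) = 16 * t := by rw [ht]; ring
    linarith
  rw [norm_mul]
  calc ‖locPref v w x‖ * _ ≤ (1 + 4 * t) * (1 + 16 * t) :=
        mul_le_mul hP hbr (norm_nonneg _) (by positivity)
    _ = 1 + 20 * t + 64 * t * t := by ring
    _ ≤ 1 + 23 * t := by nlinarith
    _ = 1 + 23 / (q : ℝ) := by rw [ht]; ring

/-- **`‖λ₂(q)‖ ≤ 1 + 3/q` for every prime `q ≥ 23`.** [cite: Zhang2022LandauSiegel, §16 p.90 (u014)] -/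
theorem norm_lam2_prime_le_sharp (c' : ℝ) {D : ℕ} (χ : DirichletCharacter ℂ D) {q : ℕ}
    (hq : q.Prime) (h23 : 23 ≤ q) : ‖lam2 c' χ q 1‖ ≤ 1 + 3 / (q : ℝ) := by
  rw [lam2_prime_one_eq_locLam c' χ hq]
  have hvn : ‖χ (q : ZMod D)‖ ≤ 1 := DirichletCharacter.norm_le_one χ _
  have hwn : ‖(q : ℂ) ^ (-beta1 c' D)‖ ≤ 1 := le_of_eq (norm_cpow_neg_beta1 c' hq.pos).1
  have hxn : ‖(q : ℂ) ^ (-(1 - betaJ c' D 1))‖ ≤ (q : ℝ)⁻¹ :=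
    le_of_eq (norm_cpow_neg_one_sub_betaJ c' hq.pos 1)
  obtain ⟨-, -, -, -, h1⟩ := basic_local_bounds (v := χ (q : ZMod D))
    (w := (q : ℂ) ^ (-beta1 c' D)) (x := (q : ℂ) ^ (-(1 - betaJ c' D 1))) h23 hvn hwn hxn
  calc ‖locLam (χ (q : ZMod D)) ((q : ℂ) ^ (-beta1 c' D)) q‖
      = ‖1 + (locLam (χ (q : ZMod D)) ((q : ℂ) ^ (-beta1 c' D)) q - 1)‖ := by ring_nf
    _ ≤ ‖(1 : ℂ)‖ + ‖locLam (χ (q : ZMod D)) ((q : ℂ) ^ (-beta1 c' D)) q - 1‖ := norm_add_le _ _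
    _ ≤ 1 + 3 / (q : ℝ) := by rw [norm_one]; linarith

/-- **Uniform forms**: `‖F_q(d,l;1−β_j)‖ ≤ 1 + 2882/q` and `‖λ₂(q)‖ ≤ 1 + 66/q` at EVERY prime
(`q < 23`: `132 ≤ 1 + 2882/q`, `3 ≤ 1 + 66/q`). [cite: Zhang2022LandauSiegel, §16 p.93] -/
theorem norm_calM2Factor_le_uniform (c' : ℝ) {D : ℕ} (χ : DirichletCharacter ℂ D) {q : ℕ}
    (hq : q.Prime) (d l j : ℕ) :
    ‖calM2Factor c' χ q d l (1 - betaJ c' D j)‖ ≤ 1 + 2882 / (q : ℝ) ∧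
      ‖lam2 c' χ q 1‖ ≤ 1 + 66 / (q : ℝ) := by
  have hq0 : (0 : ℝ) < q := by exact_mod_cast hq.pos
  by_cases h23 : 23 ≤ q
  · refine ⟨(norm_calM2Factor_le_sharp c' χ hq h23 d l j).trans ?_,
      (norm_lam2_prime_le_sharp c' χ hq h23).trans ?_⟩
    · gcongr; norm_num
    · gcongr; norm_num
  · have hq22 : (q : ℝ) ≤ 22 := by exact_mod_cast (show q ≤ 22 by omega)
    refine ⟨(norm_calM2Factor_le_crude c' χ hq d l j).trans ?_,
      (norm_lam2_prime_le_three c' χ hq).trans ?_⟩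
    · rw [← sub_nonneg]
      have : 131 ≤ 2882 / (q : ℝ) := by rw [le_div_iff₀ hq0]; nlinarith
      linarith
    · have : 2 ≤ 66 / (q : ℝ) := by rw [le_div_iff₀ hq0]; nlinarith
      linarith


/-! ## §3. The division-free splitting `𝓜₂(d,l;s) = E(n,s)·∏_{q∣n}F_q(d,l;s)` (`dl = n`) -/

/-- `Σ'_{q prime} 225·q^{−2} ≤ 450` (`Σ_n n^{−2} = π²/6 ≤ 2`). [folklore] -/
private theorem tsum_primes_bound :
    Summable (fun q : Nat.Primes => (225 : ℝ) * ((q : ℕ) : ℝ) ^ (-(2 : ℝ))) ∧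
      ∑' q : Nat.Primes, (225 : ℝ) * ((q : ℕ) : ℝ) ^ (-(2 : ℝ)) ≤ 450 := by
  have hsP : Summable (fun q : Nat.Primes => ((q : ℕ) : ℝ) ^ (-(2 : ℝ))) :=
    Nat.Primes.summable_rpow.mpr (by norm_num)
  refine ⟨hsP.mul_left 225, ?_⟩
  have hsN : Summable (fun n : ℕ => (n : ℝ) ^ (-(2 : ℝ))) :=
    Real.summable_nat_rpow.mpr (by norm_num)
  have hle : ∑' q : Nat.Primes, ((q : ℕ) : ℝ) ^ (-(2 : ℝ)) ≤ ∑' n : ℕ, (n : ℝ) ^ (-(2 : ℝ)) := by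
    have := tsum_comp_le_tsum_of_inj hsN (fun n => by positivity) (i := fun q : Nat.Primes => (q : ℕ))
      (fun a b h => Subtype.ext h)
    simpa [Function.comp_def] using this
  have hzeta : ∑' n : ℕ, (n : ℝ) ^ (-(2 : ℝ)) = Real.pi ^ 2 / 6 := by
    have h := hasSum_zeta_two.tsum_eq
    rw [← h]
    refine tsum_congr fun n => ?_
    rw [Real.rpow_neg (Nat.cast_nonneg n), one_div]
    norm_num
  have hπ : Real.pi ^ 2 / 6 ≤ 2 := by nlinarith [Real.pi_lt_d2, Real.pi_pos]
  rw [tsum_mul_left]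
  linarith [hle, hzeta]

/-- **Division-free splitting of the Euler product** at `s = 1 − β_j`: for `n ≥ 1` there is
`E = E(n) ∈ ℂ` with `‖E‖ ≤ e^{450}` (namely `∏'_{q∤n}F_q(1,1;s)`) such that for every factorisation
`n = dl`, `𝓜₂(d,l;s) = E·∏_{q∣n}F_q(d,l;s)` — by locality (`calM2Factor_eq_one_one_of_coprime`: off
the primes of `n` the factor is the generic one) and the splitting of a convergent product at a finite
set of primes. No non-vanishing of `F_q(1,1;s)` at the primes of `n` is needed (the point at `q = 2`,
`χ(2) = 1`). [cite: Zhang2022LandauSiegel, §16 p.93 (u030)] -/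
theorem calM2_eq_const_mul_prod (c' : ℝ) {D : ℕ} (χ : DirichletCharacter ℂ D) (j : ℕ) {n : ℕ}
    (hn : n ≠ 0) :
    ∃ E : ℂ, ‖E‖ ≤ Real.exp 450 ∧ ∀ x ∈ n.divisorsAntidiagonal,
      calM2 c' χ x.1 x.2 (1 - betaJ c' D j) =
        E * ∏ q ∈ n.primeFactors, calM2Factor c' χ q x.1 x.2 (1 - betaJ c' D j) := by
  set s : ℂ := 1 - betaJ c' D j with hs
  have hsre : s.re = 1 := by rw [hs, one_sub_betaJ_re]
  have hs9 : 9 / 10 ≤ s.re := by rw [hsre]; norm_num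
  have hs0 : 0 < s.re := by rw [hsre]; norm_num
  set S : Finset Nat.Primes := n.primeFactors.subtype Nat.Prime with hSdef
  set E : ℂ := ∏' q : ↥((↑S : Set Nat.Primes)ᶜ), calM2Factor c' χ ((q : Nat.Primes) : ℕ) 1 1 s
    with hEdef
  -- multipliability off `S` and the norm bound
  obtain ⟨hbsum, hble⟩ := tsum_primes_bound
  have hb : ∀ q : Nat.Primes, ‖calM2Factor c' χ (q : ℕ) 1 1 s - 1‖ ≤
      (225 : ℝ) * ((q : ℕ) : ℝ) ^ (-(2 : ℝ)) := by
    intro q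
    have h := norm_calM2Factor_one_one_sub_one_le c' χ q.prop hs9
    rw [hsre] at h
    have hq0 : (0 : ℝ) < ((q : ℕ) : ℝ) := by exact_mod_cast q.prop.pos
    have e : (225 : ℝ) * ((q : ℕ) : ℝ) ^ (-(1 : ℝ)) / ((q : ℕ) : ℝ) =
        225 * ((q : ℕ) : ℝ) ^ (-(2 : ℝ)) := by
      rw [Real.rpow_neg hq0.le, Real.rpow_neg hq0.le, Real.rpow_one]
      field_simp
      norm_num
    rw [← e]; exact h
  have hsumS : Summable (fun q : ↥((↑S : Set Nat.Primes)ᶜ) =>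
      ‖calM2Factor c' χ ((q : Nat.Primes) : ℕ) 1 1 s - 1‖) :=
    (summable_norm_calM2Factor_one_one_sub_one c' χ hs9).subtype _
  have hm11 : Multipliable ((fun q : Nat.Primes => calM2Factor c' χ (q : ℕ) 1 1 s) ∘ (↑) :
      ↥((↑S : Set Nat.Primes)ᶜ) → ℂ) :=
    Literature.Analysis.Complex.multipliable_of_summable_norm_sub_one hsumS
  have hEle : ‖E‖ ≤ Real.exp 450 := by
    have hbS : Summable (fun q : ↥((↑S : Set Nat.Primes)ᶜ) =>
        (225 : ℝ) * (((q : Nat.Primes) : ℕ) : ℝ) ^ (-(2 : ℝ))) := hbsum.subtype _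
    have h1 := Literature.Analysis.Complex.norm_tprod_le_exp_tsum_const hbS (fun q => hb q)
    refine h1.trans (Real.exp_le_exp.mpr ?_)
    have h2 : ∑' q : ↥((↑S : Set Nat.Primes)ᶜ), (225 : ℝ) * (((q : Nat.Primes) : ℕ) : ℝ) ^ (-(2 : ℝ)) ≤
        ∑' q : Nat.Primes, (225 : ℝ) * ((q : ℕ) : ℝ) ^ (-(2 : ℝ)) := by
      have := tsum_comp_le_tsum_of_inj hbsum (fun q => by positivity)
        (i := fun q : ↥((↑S : Set Nat.Primes)ᶜ) => (q : Nat.Primes)) Subtype.val_injective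
      simpa [Function.comp_def] using this
    exact h2.trans hble
  refine ⟨E, hEle, fun x hx => ?_⟩
  obtain ⟨hxn, -⟩ := Nat.mem_divisorsAntidiagonal.mp hx
  have hd0 : x.1 ≠ 0 := by rintro h; rw [h, zero_mul] at hxn; exact hn hxn.symm
  have hl0 : x.2 ≠ 0 := by rintro h; rw [h, mul_zero] at hxn; exact hn hxn.symm
  -- locality off `S`
  have hloc : ∀ q : ↥((↑S : Set Nat.Primes)ᶜ),
      calM2Factor c' χ ((q : Nat.Primes) : ℕ) x.1 x.2 s = calM2Factor c' χ ((q : Nat.Primes) : ℕ) 1 1 s := by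
    intro q
    have hq : (q : Nat.Primes) ∉ ((↑S : Set Nat.Primes)) := q.prop
    have hqp : ((q : Nat.Primes) : ℕ).Prime := (q : Nat.Primes).prop
    have hndvd : ¬ ((q : Nat.Primes) : ℕ) ∣ n := fun hdvd =>
      hq (Finset.mem_subtype.mpr (Nat.mem_primeFactors.mpr ⟨hqp, hdvd, hn⟩))
    have hcd : Nat.Coprime ((q : Nat.Primes) : ℕ) x.1 :=
      (Nat.Prime.coprime_iff_not_dvd hqp).mpr fun h => hndvd (hxn ▸ dvd_mul_of_dvd_left h _)
    have hcl : Nat.Coprime ((q : Nat.Primes) : ℕ) x.2 :=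
      (Nat.Prime.coprime_iff_not_dvd hqp).mpr fun h => hndvd (hxn ▸ dvd_mul_of_dvd_right h _)
    exact calM2Factor_eq_one_one_of_coprime c' χ hqp hcd hcl hs0
  have hmdl : Multipliable ((fun q : Nat.Primes => calM2Factor c' χ (q : ℕ) x.1 x.2 s) ∘ (↑) :
      ↥((↑S : Set Nat.Primes)ᶜ) → ℂ) :=
    hm11.congr fun q => (hloc q).symm
  have hfin : ∏ q ∈ S, calM2Factor c' χ ((q : Nat.Primes) : ℕ) x.1 x.2 s =
      ∏ q ∈ n.primeFactors, calM2Factor c' χ q x.1 x.2 s := by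
    have h1 : ∏ q ∈ S, calM2Factor c' χ ((q : Nat.Primes) : ℕ) x.1 x.2 s =
        ∏ q ∈ n.primeFactors.filter Nat.Prime, calM2Factor c' χ q x.1 x.2 s :=
      Finset.prod_subtype_eq_prod_filter (fun q => calM2Factor c' χ q x.1 x.2 s)
    rw [h1, Finset.filter_true_of_mem fun q hq => Nat.prime_of_mem_primeFactors hq]
  rw [calM2, ← Literature.NumberTheory.Automorphic.prod_mul_tprod_compl_of_multipliable S hmdl, hfin,
    mul_comm]
  congr 1
  exact tprod_congr fun q => hloc q

/-! ## §4. The inner sum against `τ₂(n)·∏_{q∣n}θ_q` -/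

/-- `β_j` is purely imaginary: `‖d^{β_j}‖ = 1` for `d ≥ 1`. [cite: Zhang2022LandauSiegel, §2 (2.13)] -/
private theorem norm_natCast_cpow_betaJ (c' : ℝ) (D j : ℕ) {d : ℕ} (hd : 0 < d) :
    ‖(d : ℂ) ^ betaJ c' D j‖ = 1 := by
  have hre : (betaJ c' D j).re = 0 := by
    have := one_sub_betaJ_re c' D j
    rw [Complex.sub_re, Complex.one_re] at this; linarith
  rw [Complex.norm_natCast_cpow_of_pos hd, hre, Real.rpow_zero]

/-- `‖λ₂(d,1)‖ ≤ ∏_{q∣d}(1 + 66/q)` (`λ₂(d,1) = ∏_{q∣d}λ₂(q)`, `‖λ₂(q)‖ ≤ 1 + 66/q`).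
[cite: Zhang2022LandauSiegel, §16 p.90 (u014)] -/
theorem norm_lam2_le_prod (c' : ℝ) {D : ℕ} (χ : DirichletCharacter ℂ D) (d : ℕ) :
    ‖lam2 c' χ d 1‖ ≤ ∏ q ∈ d.primeFactors, (1 + 66 / (q : ℝ)) := by
  unfold lam2
  refine (Finset.norm_prod_le _ _).trans (Finset.prod_le_prod (fun q _ => norm_nonneg _) fun q hq => ?_)
  have hqp : q.Prime := Nat.prime_of_mem_primeFactors hq
  have e : (1 - χ (q : ZMod D) * (q : ℂ) ^ (-(1 + beta1 c' D))) / (1 - χ (q : ZMod D) * (q : ℂ) ^ (-(1 : ℂ))) =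
      lam2 c' χ q 1 := by
    unfold lam2; rw [hqp.primeFactors, Finset.prod_singleton]
  rw [e]
  exact (norm_calM2Factor_le_uniform c' χ hqp 1 1 1).2

/-- **The inner sum**: for `n ≥ 1` and `s = 1 − β_j`,
`‖Σ_{dl=n} λ₂(d,1)d^{β_j}χ(l)∏_{q∣n}F_q(d,l;s)‖ ≤ τ₂(n)·∏_{q∣n}(1+66/q)(1+2882/q)`.
[cite: Zhang2022LandauSiegel, §16 p.93] -/
theorem norm_inner_sum_le (c' : ℝ) {D : ℕ} (χ : DirichletCharacter ℂ D) (j : ℕ) {n : ℕ}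
    (hn : n ≠ 0) :
    ‖∑ x ∈ n.divisorsAntidiagonal, lam2 c' χ x.1 1 * (x.1 : ℂ) ^ betaJ c' D j * χ (x.2 : ZMod D) *
        ∏ q ∈ n.primeFactors, calM2Factor c' χ q x.1 x.2 (1 - betaJ c' D j)‖ ≤
      (n.divisors.card : ℝ) * ∏ q ∈ n.primeFactors, ((1 + 66 / (q : ℝ)) * (1 + 2882 / (q : ℝ))) := by
  set Θ : ℝ := ∏ q ∈ n.primeFactors, ((1 + 66 / (q : ℝ)) * (1 + 2882 / (q : ℝ))) with hΘ
  have hterm : ∀ x ∈ n.divisorsAntidiagonal,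
      ‖lam2 c' χ x.1 1 * (x.1 : ℂ) ^ betaJ c' D j * χ (x.2 : ZMod D) *
        ∏ q ∈ n.primeFactors, calM2Factor c' χ q x.1 x.2 (1 - betaJ c' D j)‖ ≤ Θ := by
    intro x hx
    obtain ⟨hxn, -⟩ := Nat.mem_divisorsAntidiagonal.mp hx
    have hd0 : 0 < x.1 := Nat.pos_of_ne_zero (by rintro h; rw [h, zero_mul] at hxn; exact hn hxn.symm)
    have hdvd : x.1 ∣ n := ⟨x.2, hxn.symm⟩
    rw [norm_mul, norm_mul, norm_mul, norm_natCast_cpow_betaJ c' D j hd0, mul_one]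
    have h1 : ‖lam2 c' χ x.1 1‖ ≤ ∏ q ∈ n.primeFactors, (1 + 66 / (q : ℝ)) := by
      refine (norm_lam2_le_prod c' χ x.1).trans ?_
      have hsub : x.1.primeFactors ⊆ n.primeFactors := Nat.primeFactors_mono hdvd hn
      rw [← Finset.prod_sdiff hsub]
      have hge1 : 1 ≤ ∏ q ∈ n.primeFactors \ x.1.primeFactors, (1 + 66 / (q : ℝ)) := by
        calc (1 : ℝ) = ∏ q ∈ n.primeFactors \ x.1.primeFactors, (1 : ℝ) := Finset.prod_const_one.symm
          _ ≤ ∏ q ∈ n.primeFactors \ x.1.primeFactors, (1 + 66 / (q : ℝ)) :=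
              Finset.prod_le_prod (fun q _ => zero_le_one) fun q _ => by
                have : (0 : ℝ) ≤ 66 / q := by positivity
                linarith
      exact le_mul_of_one_le_left (Finset.prod_nonneg fun q _ => by positivity) hge1
    have h2 : ‖χ (x.2 : ZMod D)‖ ≤ 1 := DirichletCharacter.norm_le_one χ _
    have h3 : ‖∏ q ∈ n.primeFactors, calM2Factor c' χ q x.1 x.2 (1 - betaJ c' D j)‖ ≤
        ∏ q ∈ n.primeFactors, (1 + 2882 / (q : ℝ)) :=
      (Finset.norm_prod_le _ _).trans (Finset.prod_le_prod (fun q _ => norm_nonneg _) fun q hq =>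
        (norm_calM2Factor_le_uniform c' χ (Nat.prime_of_mem_primeFactors hq) x.1 x.2 j).1)
    have h0 : 0 ≤ ∏ q ∈ n.primeFactors, (1 + 66 / (q : ℝ)) := Finset.prod_nonneg fun q _ => by positivity
    calc ‖lam2 c' χ x.1 1‖ * ‖χ (x.2 : ZMod D)‖ *
          ‖∏ q ∈ n.primeFactors, calM2Factor c' χ q x.1 x.2 (1 - betaJ c' D j)‖
        ≤ (∏ q ∈ n.primeFactors, (1 + 66 / (q : ℝ))) * 1 * ∏ q ∈ n.primeFactors, (1 + 2882 / (q : ℝ)) := by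
          refine mul_le_mul (mul_le_mul h1 h2 (norm_nonneg _) h0) h3 (norm_nonneg _) (by positivity)
      _ = Θ := by rw [hΘ, mul_one, ← Finset.prod_mul_distrib]
  have hcard : (n.divisorsAntidiagonal.card : ℝ) = n.divisors.card := by
    rw [← Nat.map_div_right_divisors, Finset.card_map]
  calc ‖∑ x ∈ n.divisorsAntidiagonal, lam2 c' χ x.1 1 * (x.1 : ℂ) ^ betaJ c' D j * χ (x.2 : ZMod D) *
        ∏ q ∈ n.primeFactors, calM2Factor c' χ q x.1 x.2 (1 - betaJ c' D j)‖
      ≤ ∑ x ∈ n.divisorsAntidiagonal, Θ := (norm_sum_le _ _).trans (Finset.sum_le_sum hterm)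
    _ = (n.divisors.card : ℝ) * Θ := by rw [Finset.sum_const, nsmul_eq_mul, hcard]


/-! ## §5. Counting and assembly -/

/-- `τ₃(n) = ∏_{q^r∥n}(r+1)(r+2)/2` (`n ≥ 1`). [cite: Zhang2022LandauSiegel, §16 p.94] -/
theorem tau3R_eq_prod {n : ℕ} (hn : n ≠ 0) :
    tau3R n = ∏ q ∈ n.primeFactors,
      (((n.factorization q : ℕ) : ℝ) + 1) * ((n.factorization q : ℕ) + 2) / 2 := by
  have hmult : ArithmeticFunction.IsMultiplicative
      (ArithmeticFunction.sigma 0 * ArithmeticFunction.zeta : ArithmeticFunction ℕ) :=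
    ArithmeticFunction.isMultiplicative_sigma.mul ArithmeticFunction.isMultiplicative_zeta
  rw [tau3R_eq_sigma_mul_zeta, hmult.multiplicative_factorization _ hn, Finsupp.prod,
    Nat.support_factorization, Nat.cast_prod]
  refine Finset.prod_congr rfl fun q hq => ?_
  rw [← tau3R_eq_sigma_mul_zeta, tau3R_prime_pow (Nat.prime_of_mem_primeFactors hq)]

/-- `(r+1)²(r+2) ≤ 54·(3/2)^r` for every `r` (checked up to `r = 6`, then the ratio of consecutive
terms is `≤ 3/2`). [folklore] -/
private theorem cube_le_geom (r : ℕ) : ((r : ℝ) + 1) ^ 2 * ((r : ℝ) + 2) ≤ 54 * (3 / 2 : ℝ) ^ r := by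
  induction r with
  | zero => norm_num
  | succ r ih =>
    by_cases hr : r < 6
    · interval_cases r <;> norm_num
    · push Not at hr
      have hr' : (6 : ℝ) ≤ r := by exact_mod_cast hr
      push_cast
      have h32 : (0 : ℝ) ≤ (3 / 2 : ℝ) ^ r := by positivity
      calc ((r : ℝ) + 1 + 1) ^ 2 * ((r : ℝ) + 1 + 2) ≤ 3 / 2 * (((r : ℝ) + 1) ^ 2 * ((r : ℝ) + 2)) := by
            nlinarith
        _ ≤ 3 / 2 * (54 * (3 / 2 : ℝ) ^ r) := by linarith
        _ = 54 * (3 / 2 : ℝ) ^ (r + 1) := by ring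

/-- **The local weight against the printed profile**: for a prime `q ≥ 2`, `r ≥ 1`, `T ≥ 0`,
`(r+1)·((r+1)(r+2)/2)·θ_q ≤ 6 + C₀(1/q + T)` if `r = 1` and `≤ C₀(3/2)^r` otherwise, with
`θ_q = (1+66/q)(1+2882/q) ≤ 1 + 98054/q ≤ 49028` and `C₀ = 1323756 = 27·49028`.
[cite: Zhang2022LandauSiegel, §16 (16.15) p.94] -/
theorem local_weight_le {q r : ℕ} (hq : 2 ≤ q) (hr : 1 ≤ r) {T : ℝ} (hT : 0 ≤ T) :
    (((r : ℕ) : ℝ) + 1) * ((((r : ℕ) : ℝ) + 1) * ((r : ℕ) + 2) / 2) *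
        ((1 + 66 / (q : ℝ)) * (1 + 2882 / (q : ℝ))) ≤
      (if r = 1 then 6 + 1323756 * ((q : ℝ)⁻¹ + T) else 1323756 * (3 / 2 : ℝ) ^ r) := by
  have hq2 : (2 : ℝ) ≤ q := by exact_mod_cast hq
  have hq0 : (0 : ℝ) < q := by linarith
  set t : ℝ := (q : ℝ)⁻¹ with ht
  have ht0 : 0 < t := by positivity
  have ht2 : t ≤ 1 / 2 := by
    rw [ht, inv_eq_one_div]; exact div_le_div_of_nonneg_left (by norm_num) (by norm_num) hq2
  have hθ : (1 + 66 / (q : ℝ)) * (1 + 2882 / (q : ℝ)) ≤ 1 + 98054 * t := by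
    have e : (1 + 66 / (q : ℝ)) * (1 + 2882 / (q : ℝ)) = 1 + 2948 * t + 190212 * t * t := by
      rw [ht]; field_simp; ring
    rw [e]; nlinarith
  have hθ' : (1 + 66 / (q : ℝ)) * (1 + 2882 / (q : ℝ)) ≤ 49028 := by nlinarith
  have hθ0 : 0 ≤ (1 + 66 / (q : ℝ)) * (1 + 2882 / (q : ℝ)) := by positivity
  split_ifs with h1
  · subst h1
    push_cast
    nlinarith
  · have hcube := cube_le_geom r
    have hpoly : (((r : ℕ) : ℝ) + 1) * ((((r : ℕ) : ℝ) + 1) * ((r : ℕ) + 2) / 2) ≤ 27 * (3 / 2 : ℝ) ^ r := by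
      nlinarith
    have hpoly0 : 0 ≤ (((r : ℕ) : ℝ) + 1) * ((((r : ℕ) : ℝ) + 1) * ((r : ℕ) + 2) / 2) := by positivity
    calc _ ≤ 27 * (3 / 2 : ℝ) ^ r * 49028 := mul_le_mul hpoly hθ' hθ0 (by positivity)
      _ = 1323756 * (3 / 2 : ℝ) ^ r := by ring

set_option maxHeartbeats 1600000 in
/-- **T3-s — the pointwise local multiplicative majorant of `|ϖ₂ⱼ(n₁)|τ₃(n₁)`** (the hypothesis
`hloc` of `inline16_varpi2WeightSum_of_localMajorant`, verbatim): there are `K₀, C₀ ≥ 0` such that for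
all large `D` under (A), `j = 1, 2`, every `n₁ ∈ 𝒩(𝔮)` with `n₁ < T`,
`|ϖ₂ⱼ(n₁)|τ₃(n₁) ≤ K₀∏_{q^r∥n₁}a(q,r)`, `a(q,1) = 6 + C₀(q⁻¹ + α𝓛 log q)`, `a(q,r) = C₀(3/2)^r`
(`r ≥ 2`); here `K₀ = e^{450}/c₀` (`c₀` = the Lemma 16.1 lower bound for `|𝓜₂*|` near `1`) and
`C₀ = 1323756`. (The hypotheses `n₁ ∈ 𝒩(𝔮)`, `n₁ < T` are not used beyond `n₁ ≥ 1`.)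
[cite: Zhang2022LandauSiegel, §16 (16.15) p.94] -/
theorem varpi2_localMajorant (c' : ℝ) :
    ∃ K₀ C₀ : ℝ, 0 ≤ K₀ ∧ 0 ≤ C₀ ∧ ForAllLarge fun D _ χ => AssumptionA D χ →
      ∀ j ∈ ({1, 2} : Finset ℕ), ∀ n₁ : ℕ, n₁ ∈ nset (frakq D) → (n₁ : ℝ) < bigT D →
        ‖varpi2 c' χ j n₁‖ * tau3R n₁ ≤ K₀ * ∏ q ∈ n₁.primeFactors,
          (if n₁.factorization q = 1 then 6 + C₀ * ((q : ℝ)⁻¹ + alpha D * ell D * Real.log q)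
            else C₀ * (3 / 2 : ℝ) ^ n₁.factorization q) := by
  obtain ⟨c₀, hc₀, D₀, hM⟩ := inline16_calM2starLarge_of_lemma161 c' (AppendixA.lemma161_holds c')
  obtain ⟨D₁, hD₁⟩ := exists_forall_le_ell (max 2 (Real.pi * (5 * |c'| + 1)))
  refine ⟨Real.exp 450 / c₀, 1323756, by positivity, by norm_num, max D₀ D₁,
    fun D _ χ hD hq hp hA j hj n₁ hn₁ _ => ?_⟩
  have hD₀ : D₀ ≤ D := le_trans (le_max_left _ _) hD
  have hL := hD₁ D (le_trans (le_max_right _ _) hD)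
  have hℓ2 : 2 ≤ ell D := le_trans (le_max_left _ _) hL
  have hℓπ : Real.pi * (5 * |c'| + 1) ≤ ell D := le_trans (le_max_right _ _) hL
  have hℓ0 : 0 < ell D := by linarith
  have hα0 : 0 < alpha D := Skeleton.alpha_pos_of_ell_pos hℓ0
  have hβ : ‖betaJ c' D j‖ < 5 * alpha D := norm_betaJ_lt_five_alpha hℓ2 hℓπ hj
  set s : ℂ := 1 - betaJ c' D j with hs
  have hMs : c₀ ≤ ‖calM2star c' χ s‖ := by
    refine hM D χ hD₀ hq hp hA s ?_
    rw [hs, sub_sub_cancel_left, norm_neg]; exact hβ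
  have hn0 : n₁ ≠ 0 := hn₁.1.ne'
  obtain ⟨E, hE, hsplit⟩ := calM2_eq_const_mul_prod c' χ j hn0
  -- factor `E/𝓜₂*` out of `ϖ₂ⱼ(n₁)`
  have hfac : varpi2 c' χ j n₁ = E / calM2star c' χ s *
      ∑ x ∈ n₁.divisorsAntidiagonal, lam2 c' χ x.1 1 * (x.1 : ℂ) ^ betaJ c' D j * χ (x.2 : ZMod D) *
        ∏ q ∈ n₁.primeFactors, calM2Factor c' χ q x.1 x.2 s := by
    unfold varpi2
    rw [Finset.mul_sum]
    refine Finset.sum_congr rfl fun x hx => ?_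
    rw [← hs, hsplit x hx]
    ring
  have hvarpi : ‖varpi2 c' χ j n₁‖ ≤ Real.exp 450 / c₀ *
      ((n₁.divisors.card : ℝ) * ∏ q ∈ n₁.primeFactors, ((1 + 66 / (q : ℝ)) * (1 + 2882 / (q : ℝ)))) := by
    rw [hfac, norm_mul, norm_div]
    refine mul_le_mul ?_ (norm_inner_sum_le c' χ j hn0) (norm_nonneg _) (by positivity)
    exact div_le_div₀ (by positivity) hE hc₀ hMs
  -- multiply by `τ₃(n₁)` and regroup prime by prime
  have hτ0 : 0 ≤ tau3R n₁ := Finset.sum_nonneg fun _ _ => Nat.cast_nonneg _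
  have hcard : (n₁.divisors.card : ℝ) = ∏ q ∈ n₁.primeFactors, (((n₁.factorization q : ℕ) : ℝ) + 1) := by
    rw [Nat.card_divisors hn0, Nat.cast_prod]
    push_cast
    rfl
  have hregroup : (n₁.divisors.card : ℝ) *
      (∏ q ∈ n₁.primeFactors, ((1 + 66 / (q : ℝ)) * (1 + 2882 / (q : ℝ)))) * tau3R n₁ =
      ∏ q ∈ n₁.primeFactors, ((((n₁.factorization q : ℕ) : ℝ) + 1) *
        ((((n₁.factorization q : ℕ) : ℝ) + 1) * ((n₁.factorization q : ℕ) + 2) / 2) *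
          ((1 + 66 / (q : ℝ)) * (1 + 2882 / (q : ℝ)))) := by
    rw [hcard, tau3R_eq_prod hn0, ← Finset.prod_mul_distrib, ← Finset.prod_mul_distrib]
    exact Finset.prod_congr rfl fun q _ => by ring
  have hweights : ∏ q ∈ n₁.primeFactors, ((((n₁.factorization q : ℕ) : ℝ) + 1) *
        ((((n₁.factorization q : ℕ) : ℝ) + 1) * ((n₁.factorization q : ℕ) + 2) / 2) *
          ((1 + 66 / (q : ℝ)) * (1 + 2882 / (q : ℝ)))) ≤
      ∏ q ∈ n₁.primeFactors,
        (if n₁.factorization q = 1 then 6 + 1323756 * ((q : ℝ)⁻¹ + alpha D * ell D * Real.log q)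
          else 1323756 * (3 / 2 : ℝ) ^ n₁.factorization q) := by
    refine Finset.prod_le_prod (fun q _ => by positivity) fun q hq' => ?_
    have hqp : q.Prime := Nat.prime_of_mem_primeFactors hq'
    have hr1 : 1 ≤ n₁.factorization q := by
      rw [Nat.one_le_iff_ne_zero, ← Finsupp.mem_support_iff, Nat.support_factorization]; exact hq'
    have hT : 0 ≤ alpha D * ell D * Real.log q :=
      mul_nonneg (mul_nonneg hα0.le hℓ0.le) (Real.log_natCast_nonneg q)
    exact local_weight_le hqp.two_le hr1 hT
  have hK : 0 ≤ Real.exp 450 / c₀ := by positivity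
  calc ‖varpi2 c' χ j n₁‖ * tau3R n₁
      ≤ Real.exp 450 / c₀ * ((n₁.divisors.card : ℝ) *
          ∏ q ∈ n₁.primeFactors, ((1 + 66 / (q : ℝ)) * (1 + 2882 / (q : ℝ)))) * tau3R n₁ :=
        mul_le_mul_of_nonneg_right hvarpi hτ0
    _ = Real.exp 450 / c₀ * ((n₁.divisors.card : ℝ) *
          (∏ q ∈ n₁.primeFactors, ((1 + 66 / (q : ℝ)) * (1 + 2882 / (q : ℝ)))) * tau3R n₁) := by ring
    _ ≤ Real.exp 450 / c₀ * ∏ q ∈ n₁.primeFactors,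
          (if n₁.factorization q = 1 then 6 + 1323756 * ((q : ℝ)⁻¹ + alpha D * ell D * Real.log q)
            else 1323756 * (3 / 2 : ℝ) ^ n₁.factorization q) := by
        rw [hregroup]; exact mul_le_mul_of_nonneg_left hweights hK

/-! ## §6. The two T2 nodes -/

/-- **`Typed.Section16B.Inline16_varpi2WeightSum c′` HOLDS** (every `c′`): the summation edge
`inline16_varpi2WeightSum_of_localMajorant` applied to `varpi2_localMajorant`.
[cite: Zhang2022LandauSiegel, §16 (16.15) p.94] -/
theorem inline16_varpi2WeightSum_holds (c' : ℝ) : Inline16_varpi2WeightSum c' :=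
  inline16_varpi2WeightSum_of_localMajorant c' (varpi2_localMajorant c')

variable (c' : ℝ) in
/-- `Inline16_varpi2WeightSum` — `_holds` alias of `inline16_varpi2WeightSum_holds` above under the fact's exact name, stated under the
prover's own binders as section variables (appended 2026-08-28, D-0026 bookkeeping: the proof term is the
existing theorem of this file; no statement, definition or attribute is edited; no new named fact; the
ledger's debt table listed the fact unproved). [cite: Zhang2022LandauSiegel, §16 (16.15) p.94] -/
theorem _root_.Literature.NumberTheory.LFunctions.Zhang2022.Typed.Section16B.Inline16_varpi2WeightSum_holds :
    _root_.Literature.NumberTheory.LFunctions.Zhang2022.Typed.Section16B.Inline16_varpi2WeightSum c' :=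
  _root_.Literature.NumberTheory.LFunctions.Zhang2022.Typed.Section16B.inline16_varpi2WeightSum_holds (c' := c')

/-- **`Inline16_nsetRemovable c′` from the rough multiplicative majorant (R) alone** (the smooth input
is now discharged). [cite: Zhang2022LandauSiegel, §16 (16.15) p.94] -/
theorem inline16_nsetRemovable_of_R (c' : ℝ)
    (hR : ∃ C₀ : ℝ, 0 ≤ C₀ ∧ ForAllLarge fun D _ χ => AssumptionA D χ → ∀ j ∈ ({1, 2} : Finset ℕ),
      ∀ q r : ℕ, q.Prime → ¬ q ∣ frakq D → 1 ≤ r → ((q ^ r : ℕ) : ℝ) < bigT D ^ 5 →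
        ‖varpi2loc c' χ j (q ^ r)‖ * tau3R (q ^ r) ≤
          if r = 1 then 3 * ‖nu χ q‖ + C₀ * (alpha D * Real.log q + (q : ℝ)⁻¹)
            else C₀ * (3 / 2 : ℝ) ^ r) :
    Inline16_nsetRemovable c' :=
  inline16_nsetRemovable_of_roughMajorant c' (inline16_varpi2WeightSum_holds c') hR

/-- **`Inline16_nsetRemovableE e1pp c′` from (R) alone** (E-twin). [cite: Zhang2022LandauSiegel, §16 (16.15) p.94] -/
theorem inline16_nsetRemovableE_of_R (e1pp : ℕ → ℂ) (c' : ℝ)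
    (hR : ∃ C₀ : ℝ, 0 ≤ C₀ ∧ ForAllLarge fun D _ χ => AssumptionA D χ → ∀ j ∈ ({1, 2} : Finset ℕ),
      ∀ q r : ℕ, q.Prime → ¬ q ∣ frakq D → 1 ≤ r → ((q ^ r : ℕ) : ℝ) < bigT D ^ 5 →
        ‖varpi2loc c' χ j (q ^ r)‖ * tau3R (q ^ r) ≤
          if r = 1 then 3 * ‖nu χ q‖ + C₀ * (alpha D * Real.log q + (q : ℝ)⁻¹)
            else C₀ * (3 / 2 : ℝ) ^ r) :
    Inline16_nsetRemovableE e1pp c' :=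
  inline16_nsetRemovableE_of_roughMajorant e1pp c' (inline16_varpi2WeightSum_holds c') hR

end Literature.NumberTheory.LFunctions.Zhang2022.Typed.Section16B

end
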